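import Literature.Probability.LatticeModels.DobrushinMetricInfiniteRange
import HarnessLib

/-!
# Venture YMGap, track ROBUST-BALL (tier 2) — Dobrushin–Föllmer covariance estimate for a QUASILOCAL
# observable against a bounded local one (Föllmer's class `L` as printed)

HONEST FRAMING. WHAT THIS IS: a venture file (cell `pub-ymgap`, track Y2 ROBUST-BALL, seat ds-3), generic
Dobrushin–Föllmer bookkeeping (any index set `V`, spin space `S`, specification `γ` whose one-site laws
satisfy the GLOBAL Kantorovich–Rubinstein bound with summable rows, exactly the hypotheses of lit-1's
`DobrushinMetricInfiniteRange.lean`). Föllmer (LNM 1362, Ch. I, Thm. (2.13) with Cor. (2.14)) states the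
covariance estimate for the class `L = {f : ∑_i δ_i(f) < ∞}` of observables with a SUMMABLE GLOBAL Lipschitz
vector — QUASILOCAL observables, not only cylinder functions; lit-1's tree theorem
`abs_covariance_le_of_summable_weighted` specialises to a local `f` (a `DependsOn` hypothesis). This file
removes that restriction, which is what the tier-2 (infinite-range) massive bridge needs (the kernel
average `γ^W_Λ F` of an infinite-range member reads every link):
(1) `abs_sub_le_tsum_of_isLipBound_of_quasilocal` — SITEWISE Lipschitz bounds `δ` (summable) plus
    quasilocality (continuity at infinity) give the GLOBAL bound `|f σ − f τ| ≤ ∑' y, δ y · r(σ y, τ y)` for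
    ALL `σ, τ` (Föllmer (2.20) with (2.4), for observables instead of one-site laws);
(2) `abs_covariance_le_of_summable_weighted_quasilocal` — for a Gibbs measure `μ`, `f` bounded measurable
    with a global summable Lipschitz vector `δ_f` (NO dependence set) and `g` bounded measurable LOCAL with
    oscillation `≤ S_g` (NO Lipschitz hypothesis), under the weighted row condition off `Δ_g`:
    `|cov_μ(f, g)| ≤ 2 S_g R ∑' y, θ y δ_f y` (tilt trick `μ` vs `g̃μ/μ(g̃)` + lit-1's PUBLIC abstract
    comparison estimate `abs_sub_le_tsum_weighted`; the two "state" lemmas are re-derived here because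
    lit-1's are private);
(3) `abs_covariance_le_of_summable_exp_profile_quasilocal` — the exponential-profile form
    `|cov_μ(f, g)| ≤ 2 S_g R ∑' y, e^{−t ρ(y)} δ_f y` under the `e^{t d}`-weighted rows (Föllmer (2.23)–(2.24)).
WHAT IT IS NOT: no lattice, no gauge theory, no number of the cell; nothing about the continuum.

References: H. Föllmer, LNM 1362 (1988), Ch. I: (2.4), Lemma (2.5), Thm. (2.8), Thm. (2.13), Cor. (2.14),
Remark (2.17), (2.20)–(2.24); H.-O. Georgii, Gibbs Measures and Phase Transitions (2011), Thm. 8.20,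
Remark 8.26; H. Künsch, Comm. Math. Phys. 84 (1982) 207–222.
-/

noncomputable section

open MeasureTheory ProbabilityTheory Finset Function Filter
open scoped Topology
open Literature.Probability.LatticeModels
open Literature.Probability.LatticeModels.DobrushinMetric

namespace Summit.Ventures.YMGap.RobustBall

variable {V S : Type*}

/-! ### Sitewise Lipschitz bounds and quasilocality give the global summable Lipschitz bound -/

section Global

variable {r : S → S → ℝ}

/-- **From sitewise Lipschitz bounds and quasilocality to the global bound** (Föllmer 1988, Ch. I,
(2.20) with the continuity requirement (2.4), here for an observable): if `δ` bounds the coordinatewise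
`r`-Lipschitz constants of `f` (`IsLipBound r f δ`) with `δ` summable and `0 ≤ r ≤ R`, and `f` is
QUASILOCAL — for every `ε > 0` there is a finite `Λ` such that configurations agreeing on `Λ` have
`f`-values within `ε` — then `|f σ − f τ| ≤ ∑' y, δ y · r(σ y, τ y)` for ALL `σ, τ`: change the
coordinates on a finite set one at a time, and pay `ε` for the rest. -/
theorem abs_sub_le_tsum_of_isLipBound_of_quasilocal [DecidableEq V] {R : ℝ}
    (hr0 : ∀ a b, 0 ≤ r a b) (hrR : ∀ a b, r a b ≤ R) {f : (V → S) → ℝ} {δ : V → ℝ}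
    (hδ : IsLipBound r f δ) (hδs : Summable δ)
    (hql : ∀ ε : ℝ, 0 < ε → ∃ Λ : Finset V, ∀ σ τ : V → S, (∀ z ∈ Λ, σ z = τ z) → |f σ - f τ| ≤ ε)
    (σ τ : V → S) : |f σ - f τ| ≤ ∑' y, δ y * r (σ y) (τ y) := by
  have hδ0 := hδ.nonneg
  have hs : Summable fun y => δ y * r (σ y) (τ y) :=
    Summable.of_nonneg_of_le (fun y => mul_nonneg (hδ0 y) (hr0 _ _))
      (fun y => mul_le_mul_of_nonneg_left (hrR _ _) (hδ0 y)) (hδs.mul_right R)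
  refine le_of_forall_pos_le_add fun ε hε => ?_
  obtain ⟨Λ, hΛ⟩ := hql ε hε
  -- telescope over a finite set: `s.piecewise σ τ` is `σ` on `s`, `τ` off `s`
  have h2 : ∀ s : Finset V, |f (s.piecewise σ τ) - f τ| ≤ ∑ y ∈ s, δ y * r (σ y) (τ y) := by
    intro s
    induction s using Finset.induction_on with
    | empty => simp
    | insert y s hys ih =>
      have hstep : |f ((insert y s).piecewise σ τ) - f (s.piecewise σ τ)| ≤ δ y * r (σ y) (τ y) := by
        have h := hδ.le y ((insert y s).piecewise σ τ) (s.piecewise σ τ)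
          (fun z hz => by rw [Finset.piecewise_insert_of_ne _ _ _ hz])
        rwa [Finset.piecewise_eq_of_mem _ _ _ (Finset.mem_insert_self y s),
          Finset.piecewise_eq_of_notMem _ _ _ hys] at h
      rw [Finset.sum_insert hys]
      calc |f ((insert y s).piecewise σ τ) - f τ|
          ≤ |f ((insert y s).piecewise σ τ) - f (s.piecewise σ τ)| + |f (s.piecewise σ τ) - f τ| :=
            abs_sub_le _ _ _
        _ ≤ δ y * r (σ y) (τ y) + ∑ z ∈ s, δ z * r (σ z) (τ z) := add_le_add hstep ih
  have h1 : |f σ - f (Λ.piecewise σ τ)| ≤ ε :=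
    hΛ σ _ fun z hz => (Finset.piecewise_eq_of_mem _ _ _ hz).symm
  have h3 : ∑ y ∈ Λ, δ y * r (σ y) (τ y) ≤ ∑' y, δ y * r (σ y) (τ y) :=
    hs.sum_le_tsum Λ fun y _ => mul_nonneg (hδ0 y) (hr0 _ _)
  calc |f σ - f τ| ≤ |f σ - f (Λ.piecewise σ τ)| + |f (Λ.piecewise σ τ) - f τ| := abs_sub_le _ _ _
    _ ≤ ε + ∑ y ∈ Λ, δ y * r (σ y) (τ y) := add_le_add h1 (h2 Λ)
    _ ≤ ∑' y, δ y * r (σ y) (τ y) + ε := by linarith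

end Global

/-! ### Gibbs measures and their local tilts as invariant normalised states (Föllmer's two states) -/

section States

variable [MeasurableSpace S] {γ : Specification V S} {r : S → S → ℝ} {C : V → V → ℝ}

/-- **A Gibbs measure is an invariant monotone-normalised state for every one-site operator**
(DLR equations; Föllmer 1988, Ch. I, proof of Lemma (2.5), first display; Georgii 2011, Thm. 8.7) — the
three properties of `E₁ = μ` used by the abstract comparison estimate, for the admissible class
"measurable and bounded" (re-derivation of lit-1's private lemma). -/
theorem gibbs_isState (hγ : IsSpecification γ) {μ : Measure (V → S)} (hμ : IsGibbsMeasure γ μ) :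
    (∀ ⦃F : (V → S) → ℝ⦄ ⦃M : ℝ⦄, (Measurable F ∧ ∃ B, ∀ σ, |F σ| ≤ B) → (∀ σ, F σ ≤ M) →
      ∫ σ, F σ ∂μ ≤ M) ∧
    (∀ ⦃F : (V → S) → ℝ⦄ ⦃M : ℝ⦄, (Measurable F ∧ ∃ B, ∀ σ, |F σ| ≤ B) → (∀ σ, M ≤ F σ) →
      M ≤ ∫ σ, F σ ∂μ) ∧
    (∀ ⦃F : (V → S) → ℝ⦄ (x : V), (Measurable F ∧ ∃ B, ∀ σ, |F σ| ≤ B) →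
      ∫ σ, siteAvg γ x F σ ∂μ = ∫ σ, F σ ∂μ) := by
  haveI := hμ.isProbabilityMeasure
  refine ⟨fun F M hF hM => ?_, fun F M hF hM => ?_, fun F x hF => ?_⟩
  · obtain ⟨hFm, B, hB⟩ := hF
    calc ∫ σ, F σ ∂μ ≤ ∫ _σ, M ∂μ := integral_mono (integrable_of_abs_le' hFm hB) (integrable_const M) hM
      _ = M := by simp
  · obtain ⟨hFm, B, hB⟩ := hF
    calc M = ∫ _σ, M ∂μ := by simp
      _ ≤ ∫ σ, F σ ∂μ := integral_mono (integrable_const M) (integrable_of_abs_le' hFm hB) hM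
  · obtain ⟨hFm, B, hB⟩ := hF
    exact hμ.integral_integral_eq hγ {x} (integrable_of_abs_le' hFm hB)

/-- **The tilt of a Gibbs measure by a nonnegative local density is an invariant normalised state off the
support of the density** (properness and DLR; Föllmer 1988, Ch. I, proof of Thm. (2.13): `dν = g dμ`;
Georgii 2011, §8.2; Künsch 1982) — re-derivation of lit-1's private lemma. -/
theorem tilt_isState (hγ : IsSpecification γ) {μ : Measure (V → S)} (hμ : IsGibbsMeasure γ μ)
    {g : (V → S) → ℝ} (hgm : Measurable g) {Δg : Finset V} (hgdep : DependsOn g (↑Δg : Set V))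
    (hg0 : ∀ σ, 0 ≤ g σ) {B : ℝ} (hgB : ∀ σ, g σ ≤ B) (hgpos : 0 < ∫ σ, g σ ∂μ) :
    (∀ ⦃F : (V → S) → ℝ⦄ ⦃M : ℝ⦄, (Measurable F ∧ ∃ B, ∀ σ, |F σ| ≤ B) → (∀ σ, F σ ≤ M) →
      (∫ σ, g σ * F σ ∂μ) / ∫ σ, g σ ∂μ ≤ M) ∧
    (∀ ⦃F : (V → S) → ℝ⦄ ⦃M : ℝ⦄, (Measurable F ∧ ∃ B, ∀ σ, |F σ| ≤ B) → (∀ σ, M ≤ F σ) →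
      M ≤ (∫ σ, g σ * F σ ∂μ) / ∫ σ, g σ ∂μ) ∧
    (∀ ⦃F : (V → S) → ℝ⦄ (x : V), x ∈ ((↑Δg : Set V)ᶜ) → (Measurable F ∧ ∃ B, ∀ σ, |F σ| ≤ B) →
      (∫ σ, g σ * siteAvg γ x F σ ∂μ) / ∫ σ, g σ ∂μ = (∫ σ, g σ * F σ ∂μ) / ∫ σ, g σ ∂μ) := by
  haveI := hμ.isProbabilityMeasure
  have hgabs : ∀ σ, |g σ| ≤ B := fun σ => by rw [abs_of_nonneg (hg0 σ)]; exact hgB σ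
  have hgi : Integrable g μ := integrable_of_abs_le' hgm hgabs
  have hgfi : ∀ {F : (V → S) → ℝ}, Measurable F → ∀ {M : ℝ}, (∀ σ, |F σ| ≤ M) →
      Integrable (fun σ => g σ * F σ) μ := fun hFm M hM =>
    hgi.mul_bdd hFm.aestronglyMeasurable (ae_of_all _ fun σ => by
      rw [Real.norm_eq_abs]; exact hM σ)
  refine ⟨fun F M hF hM => ?_, fun F M hF hM => ?_, fun F x hx hF => ?_⟩
  · obtain ⟨hFm, B', hB'⟩ := hF
    rw [div_le_iff₀ hgpos]
    calc ∫ σ, g σ * F σ ∂μ ≤ ∫ σ, g σ * M ∂μ :=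
          integral_mono (hgfi hFm hB') (hgi.mul_const M) fun σ => mul_le_mul_of_nonneg_left (hM σ) (hg0 σ)
      _ = M * ∫ σ, g σ ∂μ := by rw [integral_mul_const, mul_comm]
  · obtain ⟨hFm, B', hB'⟩ := hF
    rw [le_div_iff₀ hgpos]
    calc M * ∫ σ, g σ ∂μ = ∫ σ, g σ * M ∂μ := by rw [integral_mul_const, mul_comm]
      _ ≤ ∫ σ, g σ * F σ ∂μ :=
          integral_mono (hgi.mul_const M) (hgfi hFm hB') fun σ => mul_le_mul_of_nonneg_left (hM σ) (hg0 σ)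
  · obtain ⟨hFm, B', hB'⟩ := hF
    have hxΔ : x ∉ Δg := fun h => hx (Finset.mem_coe.2 h)
    have hpt : ∀ η, g η * siteAvg γ x F η = ∫ σ, g σ * F σ ∂(γ {x} η) := fun η => by
      rw [siteAvg, ← integral_const_mul]
      refine integral_congr_ae ?_
      filter_upwards [hγ.proper {x} η] with σ hσ
      rw [hgdep fun i hi => (hσ i fun hix => hxΔ ?_).symm]
      rwa [Finset.mem_singleton.1 hix] at hi
    congr 1
    simp_rw [hpt]
    exact hμ.integral_integral_eq hγ {x} (hgfi hFm hB')

/-! ### The covariance estimate for a quasilocal `f` against a bounded local `g` -/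

/-- **Covariance estimate in Dobrushin's regime for a QUASILOCAL observable against a bounded LOCAL one,
weighted row-sum condition, infinite range, Vasserstein form** (Föllmer 1988, Ch. I, Thm. (2.13)/(2.23)
with Cor. (2.14)/(2.24) for the class `L`; Georgii 2011, Remark 8.26; Künsch 1982): let the one-site laws
of `γ` satisfy the global Kantorovich–Rubinstein bound with summable rows, let `μ` be a Gibbs measure,
`f` bounded measurable with a GLOBAL summable Lipschitz vector `δ_f`
(`|f σ − f τ| ≤ ∑' y, δ_f y · r(σ y, τ y)` for all `σ, τ` — no dependence set), and `g` bounded measurable,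
depending only on the finite set `Δ_g`, of oscillation `≤ S_g` (no Lipschitz hypothesis). If off `Δ_g`
the rows are `≤ c < 1` and a weight `0 ≤ θ ≤ 1`, `= 1` on `Δ_g`, satisfies `∑' y, C x y θ y ≤ c θ x`,
then `|cov_μ(f, g)| ≤ 2 S_g R ∑' y, θ y δ_f y` (tilt trick: `μ` versus `g̃ μ/μ(g̃)`,
`g̃ = g − g(τ₀) + S_g ∈ [0, 2 S_g]`, an invariant state off `Δ_g`; then lit-1's comparison estimate
`abs_sub_le_tsum_weighted`). -/
theorem abs_covariance_le_of_summable_weighted_quasilocal [DecidableEq V] (hγ : IsSpecification γ)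
    {R : ℝ} (hr0 : ∀ a b, 0 ≤ r a b) (hrR : ∀ a b, r a b ≤ R) (hR : 0 ≤ R)
    (hr00 : ∀ a, r a a = 0) (hC0 : ∀ x y, 0 ≤ C x y) (hCs : ∀ x, Summable (C x))
    (hcontr : ∀ (x : V) (ω η : V → S) (φ : S → ℝ) (L : ℝ), Measurable φ →
      (∃ M, ∀ s, |φ s| ≤ M) → 0 ≤ L → (∀ a b, |φ a - φ b| ≤ L * r a b) →
      |∫ s, φ s ∂(siteLaw γ x ω) - ∫ s, φ s ∂(siteLaw γ x η)| ≤
        L * ∑' y, C x y * r (ω y) (η y))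
    {μ : Measure (V → S)} (hμ : IsGibbsMeasure γ μ) {f g : (V → S) → ℝ}
    (hfm : Measurable f) {Mf : ℝ} (hMf : ∀ σ, |f σ| ≤ Mf)
    {δf : V → ℝ} (hδf0 : ∀ y, 0 ≤ δf y) (hδfs : Summable δf)
    (hδf : ∀ σ τ, |f σ - f τ| ≤ ∑' y, δf y * r (σ y) (τ y))
    (hgm : Measurable g) {Δg : Finset V} (hgdep : DependsOn g (↑Δg : Set V)) {Mg : ℝ}
    (hMg : ∀ σ, |g σ| ≤ Mg) {Sg : ℝ} (hSg : ∀ σ τ, |g σ - g τ| ≤ Sg)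
    {c : ℝ} (hc0 : 0 ≤ c) (hc1 : c < 1)
    (hrow : ∀ x ∉ Δg, ∑' y, C x y ≤ c) {θ : V → ℝ} (hθ0 : ∀ y, 0 ≤ θ y) (hθ1 : ∀ y, θ y ≤ 1)
    (hθg : ∀ y ∈ Δg, θ y = 1) (hroww : ∀ x ∉ Δg, ∑' y, C x y * θ y ≤ c * θ x) :
    |cov[f, g; μ]| ≤ 2 * Sg * R * ∑' y, θ y * δf y := by
  classical
  haveI := hμ.isProbabilityMeasure
  obtain ⟨τ₀, -⟩ := nonempty_of_measure_ne_zero (μ := μ) (s := Set.univ) (by simp)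
  have hSg0 : 0 ≤ Sg := (abs_nonneg _).trans (hSg τ₀ τ₀)
  -- the shifted density `g̃ ∈ [0, 2 S_g]`
  set gt : (V → S) → ℝ := fun σ => g σ + (Sg - g τ₀) with hgt
  have hgt0 : ∀ σ, 0 ≤ gt σ := fun σ => by
    have := (abs_le.1 (hSg σ τ₀)).1; simp only [hgt]; linarith
  have hgtB : ∀ σ, gt σ ≤ 2 * Sg := fun σ => by
    have := (abs_le.1 (hSg σ τ₀)).2; simp only [hgt]; linarith
  have hgtm : Measurable gt := hgm.add_const _
  have hgtdep : DependsOn gt (↑Δg : Set V) := fun σ τ h => by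
    simp only [hgt]; rw [hgdep h]
  have hgi : Integrable g μ := integrable_of_abs_le' hgm hMg
  have hfi : Integrable f μ := integrable_of_abs_le' hfm hMf
  have hgtabs : ∀ σ, |gt σ| ≤ 2 * Sg := fun σ => by
    rw [abs_of_nonneg (hgt0 σ)]; exact hgtB σ
  have hgti : Integrable gt μ := integrable_of_abs_le' hgtm hgtabs
  -- the right-hand side is nonnegative
  have hsθ : Summable fun y => θ y * δf y :=
    Summable.of_nonneg_of_le (fun y => mul_nonneg (hθ0 y) (hδf0 y))
      (fun y => by simpa using mul_le_mul_of_nonneg_right (hθ1 y) (hδf0 y)) hδfs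
  have hRHS : 0 ≤ 2 * Sg * R * ∑' y, θ y * δf y := by
    have h2 : 0 ≤ ∑' y, θ y * δf y := tsum_nonneg fun y => mul_nonneg (hθ0 y) (hδf0 y)
    positivity
  -- `cov(f, g) = cov(f, g̃) = μ(f g̃) - μ(f) μ(g̃)`
  have hcov : cov[f, g; μ] = ∫ σ, f σ * gt σ ∂μ - (∫ σ, f σ ∂μ) * ∫ σ, gt σ ∂μ := by
    have h1 : cov[f, g; μ] = cov[f, gt; μ] := by
      rw [hgt, covariance_add_const_right hgi]
    rw [h1, covariance_eq_sub]
    · rfl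
    · exact memLp_of_bounded (a := -Mf) (b := Mf)
        (ae_of_all _ fun σ => abs_le.1 (hMf σ)) hfm.aestronglyMeasurable 2
    · exact memLp_of_bounded (a := -(2 * Sg)) (b := 2 * Sg)
        (ae_of_all _ fun σ => abs_le.1 (hgtabs σ)) hgtm.aestronglyMeasurable 2
  by_cases hz : ∫ σ, gt σ ∂μ = 0
  · -- degenerate case: `g̃ = 0` a.e.
    have hae : gt =ᵐ[μ] 0 := (integral_eq_zero_iff_of_nonneg (fun σ => hgt0 σ) hgti).1 hz
    have hfg : ∫ σ, f σ * gt σ ∂μ = 0 := by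
      rw [← integral_zero (α := V → S) (μ := μ) (G := ℝ)]
      refine integral_congr_ae ?_
      filter_upwards [hae] with σ hσ
      simp [hσ]
    rw [hcov, hfg, hz, mul_zero, sub_zero, abs_zero]
    exact hRHS
  have hpos : 0 < ∫ σ, gt σ ∂μ := lt_of_le_of_ne (integral_nonneg hgt0) (Ne.symm hz)
  -- the abstract layer: predicates and the five structural hypotheses
  set Adm : ((V → S) → ℝ) → Prop := fun F => Measurable F ∧ ∃ M, ∀ σ, |F σ| ≤ M with hAdmdef
  set Lip : ((V → S) → ℝ) → (V → ℝ) → Prop := fun F δ =>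
    (∀ y, 0 ≤ δ y) ∧ Summable δ ∧ ∀ σ τ, |F σ - F τ| ≤ ∑' y, δ y * r (σ y) (τ y) with hLipdef
  have hlip0 : ∀ ⦃F : (V → S) → ℝ⦄ ⦃δ : V → ℝ⦄, Lip F δ → ∀ y, 0 ≤ δ y := fun F δ h => h.1
  have hlips : ∀ ⦃F : (V → S) → ℝ⦄ ⦃δ : V → ℝ⦄, Lip F δ → Summable δ := fun F δ h => h.2.1
  have hosc : ∀ ⦃F : (V → S) → ℝ⦄ ⦃δ : V → ℝ⦄, Adm F → Lip F δ →
      ∀ σ τ, |F σ - F τ| ≤ R * ∑' y, δ y := by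
    intro F δ _ h σ τ
    obtain ⟨hδ0, hδs, hδ⟩ := h
    refine (hδ σ τ).trans ?_
    have hs : Summable fun y => δ y * r (σ y) (τ y) :=
      Summable.of_nonneg_of_le (fun y => mul_nonneg (hδ0 y) (hr0 _ _))
        (fun y => mul_le_mul_of_nonneg_left (hrR _ _) (hδ0 y)) (hδs.mul_right R)
    calc ∑' y, δ y * r (σ y) (τ y) ≤ ∑' y, δ y * R :=
          hs.tsum_le_tsum (fun y => mul_le_mul_of_nonneg_left (hrR _ _) (hδ0 y)) (hδs.mul_right R)
      _ = R * ∑' y, δ y := by rw [tsum_mul_right, mul_comm]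
  have hT : ∀ ⦃F : (V → S) → ℝ⦄ (x : V), Adm F → Adm (siteAvg γ x F) := by
    intro F x hF
    obtain ⟨hFm, M, hM⟩ := hF
    exact ⟨measurable_siteAvg hγ x hFm, M, fun σ => abs_siteAvg_le hγ x hM σ⟩
  have hdust : ∀ ⦃F : (V → S) → ℝ⦄ ⦃δ : V → ℝ⦄ (x : V), Adm F → Lip F δ →
      Lip (siteAvg γ x F) fun y => if y = x then 0 else δ y + C x y * δ x := by
    intro F δ x hF h
    obtain ⟨hFm, M, hM⟩ := hF
    obtain ⟨hδ0, hδs, hδ⟩ := h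
    refine ⟨fun y => ?_, ?_, lip_siteAvg_tsum hγ hr0 hrR hr00 hC0 hCs hcontr x hFm hM hδ0 hδs hδ⟩
    · dsimp only
      split_ifs
      · exact le_rfl
      · exact add_nonneg (hδ0 y) (mul_nonneg (hC0 x y) (hδ0 x))
    · exact Summable.of_nonneg_of_le
        (fun y => by
          split_ifs; exacts [le_rfl, add_nonneg (hδ0 y) (mul_nonneg (hC0 x y) (hδ0 x))])
        (fun y => by
          split_ifs
          · exact add_nonneg (hδ0 y) (mul_nonneg (hC0 x y) (hδ0 x))
          · exact le_rfl)
        (hδs.add ((hCs x).mul_right (δ x)))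
  obtain ⟨h₁le, h₁ge, h₁T⟩ := gibbs_isState hγ hμ
  obtain ⟨h₂le, h₂ge, h₂T⟩ := tilt_isState hγ hμ hgtm hgtdep hgt0 hgtB hpos
  -- `f` is admissible with the global Lipschitz vector `δ_f`
  have hF : Adm f := ⟨hfm, Mf, hMf⟩
  have hδ' : Lip f δf := ⟨hδf0, hδfs, hδf⟩
  have hW : ∀ x, x ∈ ((↑Δg : Set V)ᶜ) → x ∉ Δg := fun x hx h' =>
    (Set.mem_compl_iff _ _).1 hx (Finset.mem_coe.2 h')
  have key := abs_sub_le_tsum_weighted (W := ((↑Δg : Set V)ᶜ)) (T := fun x F => siteAvg γ x F)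
    (E₁ := fun F => ∫ σ, F σ ∂μ) (E₂ := fun F => (∫ σ, gt σ * F σ ∂μ) / ∫ σ, gt σ ∂μ)
    hR hlip0 hlips hosc hC0 hCs hT hdust
    (fun F M hF hM => h₁le hF hM) (fun F M hF hM => h₁ge hF hM) (fun F x _ hF => h₁T x hF)
    (fun F M hF hM => h₂le hF hM) (fun F M hF hM => h₂ge hF hM) (fun F x hx hF => h₂T x hx hF)
    hc0 hc1 (fun x hx => hrow x (hW x hx)) (θ := θ) hθ0 hθ1
    (fun y hy => hθg y (by simpa using hy)) (fun x hx => hroww x (hW x hx)) hF hδ'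
  have key' : |∫ σ, f σ ∂μ - (∫ σ, gt σ * f σ ∂μ) / ∫ σ, gt σ ∂μ| ≤ R * ∑' y, θ y * δf y := key
  -- `cov = μ(g̃) · (μ_{g̃}(f) - μ(f))`
  have hfgt : ∫ σ, f σ * gt σ ∂μ = ∫ σ, gt σ * f σ ∂μ :=
    integral_congr_ae (ae_of_all _ fun σ => mul_comm _ _)
  have hident : cov[f, g; μ] =
      (∫ σ, gt σ ∂μ) * ((∫ σ, gt σ * f σ ∂μ) / ∫ σ, gt σ ∂μ - ∫ σ, f σ ∂μ) := by
    rw [hcov, hfgt, mul_sub, mul_div_cancel₀ _ hz]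
    ring
  rw [hident, abs_mul, abs_of_pos hpos, abs_sub_comm]
  have hgtint : ∫ σ, gt σ ∂μ ≤ 2 * Sg := by
    calc ∫ σ, gt σ ∂μ ≤ ∫ _σ, 2 * Sg ∂μ := integral_mono hgti (integrable_const _) hgtB
      _ = 2 * Sg := by simp
  have hsum0 : 0 ≤ ∑' y, θ y * δf y := tsum_nonneg fun y => mul_nonneg (hθ0 y) (hδf0 y)
  calc (∫ σ, gt σ ∂μ) * |∫ σ, f σ ∂μ - (∫ σ, gt σ * f σ ∂μ) / ∫ σ, gt σ ∂μ|
      ≤ (2 * Sg) * (R * ∑' y, θ y * δf y) :=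
        mul_le_mul hgtint key' (abs_nonneg _) (by positivity)
    _ = 2 * Sg * R * ∑' y, θ y * δf y := by ring

/-- **Exponential-profile form** (Föllmer 1988, Ch. I, (2.23)–(2.24); Georgii 2011, Remark 8.26; Künsch
1982): with `d ≥ 0`, `t ≥ 0`, the WEIGHTED ROWS `y ↦ C x y e^{t d x y}` summable with sum `≤ c < 1` off
`Δ_g`, and a profile `ρ ≥ 0` vanishing on `Δ_g` with `ρ x ≤ ρ y + d x y` (`x ∉ Δ_g`), a quasilocal `f`
with global summable Lipschitz vector `δ_f` and a bounded local `g` of oscillation `≤ S_g` satisfy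
`|cov_μ(f, g)| ≤ 2 S_g R ∑' y, e^{−t ρ y} δ_f y`. -/
theorem abs_covariance_le_of_summable_exp_profile_quasilocal [DecidableEq V] (hγ : IsSpecification γ)
    {R : ℝ} (hr0 : ∀ a b, 0 ≤ r a b) (hrR : ∀ a b, r a b ≤ R) (hR : 0 ≤ R)
    (hr00 : ∀ a, r a a = 0) (hC0 : ∀ x y, 0 ≤ C x y) (hCs : ∀ x, Summable (C x))
    (hcontr : ∀ (x : V) (ω η : V → S) (φ : S → ℝ) (L : ℝ), Measurable φ →
      (∃ M, ∀ s, |φ s| ≤ M) → 0 ≤ L → (∀ a b, |φ a - φ b| ≤ L * r a b) →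
      |∫ s, φ s ∂(siteLaw γ x ω) - ∫ s, φ s ∂(siteLaw γ x η)| ≤
        L * ∑' y, C x y * r (ω y) (η y))
    {μ : Measure (V → S)} (hμ : IsGibbsMeasure γ μ) {f g : (V → S) → ℝ}
    (hfm : Measurable f) {Mf : ℝ} (hMf : ∀ σ, |f σ| ≤ Mf)
    {δf : V → ℝ} (hδf0 : ∀ y, 0 ≤ δf y) (hδfs : Summable δf)
    (hδf : ∀ σ τ, |f σ - f τ| ≤ ∑' y, δf y * r (σ y) (τ y))
    (hgm : Measurable g) {Δg : Finset V} (hgdep : DependsOn g (↑Δg : Set V)) {Mg : ℝ}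
    (hMg : ∀ σ, |g σ| ≤ Mg) {Sg : ℝ} (hSg : ∀ σ τ, |g σ - g τ| ≤ Sg)
    {c : ℝ} (hc0 : 0 ≤ c) (hc1 : c < 1)
    (d : V → V → ℝ) (hd : ∀ x y, 0 ≤ d x y) {t : ℝ} (ht : 0 ≤ t)
    (hsw : ∀ x ∉ Δg, Summable fun y => C x y * Real.exp (t * d x y))
    (hroww : ∀ x ∉ Δg, ∑' y, C x y * Real.exp (t * d x y) ≤ c)
    (ρ : V → ℝ) (hρ0 : ∀ y, 0 ≤ ρ y) (hρg : ∀ y ∈ Δg, ρ y = 0)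
    (hρ : ∀ x ∉ Δg, ∀ y, ρ x ≤ ρ y + d x y) :
    |cov[f, g; μ]| ≤ 2 * Sg * R * ∑' y, Real.exp (-(t * ρ y)) * δf y := by
  -- the weight `θ = e^{-t ρ}`
  have hθ0 : ∀ y, 0 ≤ Real.exp (-(t * ρ y)) := fun y => (Real.exp_pos _).le
  have hθ1 : ∀ y, Real.exp (-(t * ρ y)) ≤ 1 := fun y =>
    Real.exp_le_one_iff.2 (by nlinarith [hρ0 y])
  have hθg : ∀ y ∈ Δg, Real.exp (-(t * ρ y)) = 1 := fun y hy => by rw [hρg y hy]; simp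
  have hsθ : ∀ x, Summable fun y => C x y * Real.exp (-(t * ρ y)) := fun x =>
    Summable.of_nonneg_of_le (fun y => mul_nonneg (hC0 x y) (hθ0 y))
      (fun y => by simpa using mul_le_mul_of_nonneg_left (hθ1 y) (hC0 x y)) (hCs x)
  have hrow : ∀ x ∉ Δg, ∑' y, C x y ≤ c := fun x hx => by
    refine le_trans ((hCs x).tsum_le_tsum (fun y => ?_) (hsw x hx)) (hroww x hx)
    have h1 : (1 : ℝ) ≤ Real.exp (t * d x y) := Real.one_le_exp (mul_nonneg ht (hd x y))
    simpa using mul_le_mul_of_nonneg_left h1 (hC0 x y)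
  refine abs_covariance_le_of_summable_weighted_quasilocal hγ hr0 hrR hR hr00 hC0 hCs hcontr hμ hfm hMf
    hδf0 hδfs hδf hgm hgdep hMg hSg hc0 hc1 hrow hθ0 hθ1 hθg (fun x hx => ?_)
  calc ∑' y, C x y * Real.exp (-(t * ρ y))
      ≤ ∑' y, C x y * Real.exp (t * d x y) * Real.exp (-(t * ρ x)) := by
        refine (hsθ x).tsum_le_tsum (fun y => ?_) ((hsw x hx).mul_right _)
        rw [mul_assoc, ← Real.exp_add]
        refine mul_le_mul_of_nonneg_left (Real.exp_le_exp.2 ?_) (hC0 x y)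
        nlinarith [hρ x hx y]
    _ = (∑' y, C x y * Real.exp (t * d x y)) * Real.exp (-(t * ρ x)) := tsum_mul_right
    _ ≤ c * Real.exp (-(t * ρ x)) :=
        mul_le_mul_of_nonneg_right (hroww x hx) (Real.exp_pos _).le

end States

end Summit.Ventures.YMGap.RobustBall

end
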